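import Summits.BirchSwinnertonDyer.BirchSwinnertonDyer.Theorems.PrintCFramBottomClassIndexLawFiveLeHerbrandLineRestriction
import Summits.BirchSwinnertonDyer.BirchSwinnertonDyer.Theorems.ResidualThetaTransportAtTwoUnramifiedRestriction
import Literature.NumberTheory.EllipticCurves.IwasawaCoinvariantsRankProofs
import HarnessLib

/-!
# Crux `PrintCFram.BottomClassIndexLawFiveLe` (stmt-BirchSwinnertonDyer-20372), line `eisenstein-resource-bdp-line` (v10):
# Stub H, first step of T4 — UNTWISTING: the bottom-layer residual Selmer group of `Φ` vanishes as soon as the strict Selmer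
# group over the SPLITTING FIELD `L_θ = K̄^{N_θ}` has no non-zero `Γ_K`-invariant class

Cell `bsd-print-cfram`, LEAD seat `bsd-line-cfram-p1` (generation g8), `--supports stmt-BirchSwinnertonDyer-20372` (helper).
THEOREMS ONLY; no definition, no named fact, no `sorry`. BSD is not proved by any of this; no summit statement is proved
by this seat.

WHAT. M1 §2 of the anatomy of Stub H (`Lines/herbrand-regular-locus-M1-anatomy.md`): «inflation–restriction to `L = K̄^{ker θ}`:
`R ≅ Hom(Gal(M/L), 𝔽_p)^{[θ]}`». LEAD g7's T2 (`HerbrandLineRestriction.subgroupResKer_ker_eq_bot_of_cmRamified`) proved the restriction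
`H¹(Γ_K, Φ) → H¹(N_θ, Φ)` injective, `N_θ = ker(Γ_K → Aut Φ)`. This file turns that into the REDUCTION STEP the T4 prover starts from,
in the tree's Greenberg–Vatsal currency (`datumStrictSelmer`, any local data `L`, any `S₀`): the strict Selmer group over `K` (subgroup
`H = Γ_K`, i.e. `κ.layerSubgroup 0`) restricts INTO the strict Selmer group over `L_θ` (subgroup `N_θ`) — unramified and strict conditions
are preserved by restriction (tree: `ResidualLayer.resOfLe_mem_unramifiedOutside`, `RegularLocusTowerDescent.resOfLe_mem_strictKer_of_mem_strictKer`)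
— lands in the `Γ_K`-invariants (inner automorphisms act trivially upstairs, `conjH1_of_mem_holds`), and injectively (T2, transported
from `H¹(Γ_K, ·)` to `H¹(⊤, ·)` by the surjectivity of restriction to the full subgroup). Hence:

  **`R_𝔭^S(K, Φ) = ⊥` as soon as every `Γ_K`-INVARIANT class of the strict Selmer group of the TRIVIAL `N_θ`-module `Φ` over `L_θ`
  (unramified outside `S ∪ {p}`, strict at the `p`-data) is zero** — the statement «`Hom(Gal(M/L_θ), 𝔽_p)^{[θ]} = 0`» of M1 §2–3,

for `Φ.Sub` AND `Φ.Quot`, for every stable line of order `p` over every quadratic `K` (Stub H's quantifiers). What the T4 prover adds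
after this file is pure class field theory of the number field `L_θ` (ray class group of modulus supported on `S ∪ {𝔭̄}`, M1 §3–5) and
the cyclotomic facts F1–F4 (T5); no elliptic curve is left in the statement except through `S` and the characters `θ` (T1, p647967 ff.).

* §1 `resSubgroup_surjective_of_forall_mem`, `resOfLe_injective_of_subgroupResKer_eq_bot` — restriction to a subgroup `H` containing
  every element is onto, so T2's `subgroupResKer M N = ⊥` gives injectivity of `resOfLe M (N ≤ H)`.
* §2 `datumStrictSelmer_eq_bot_of_forall_invariant_eq_zero` — THE UNTWISTING (generic `K`, `M`, `L`, `S₀`, `N ≤ H = Γ_K`).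
* §3 `stubH_of_untwisted_of_cmRamified` — on the class: Stub H's two conclusions for `Φ` from the two untwisted vanishing statements
  over the splitting fields of `Φ.Sub` and `Φ.Quot`.

References: Serre, *Galois Cohomology* I §2.6 (b) (inflation–restriction); Greenberg, LNM 1716 §3 (restriction maps between Selmer
groups); Greenberg–Vatsal 2000 §2 (the groups); Rubin 1999 Lemma 6.2 (Sah); the herbrand M1 memo §2–3.
-/

noncomputable section

-- summit-side namespace `Summit.BirchSwinnertonDyer.BirchSwinnertonDyer.Theorems.…` (single-conjunct summit, D-0017 layout)
set_option linter.dupNamespace false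
set_option autoImplicit false

open scoped Classical
open NumberField Field IsDedekindDomain
open Literature.NumberTheory.EllipticCurves Literature.NumberTheory.EllipticCurves.GreenbergSelmer
  Literature.NumberTheory.EllipticCurves.GreenbergVatsal2000
  Literature.NumberTheory.EllipticCurves.Rank1Residual
open Summit.BirchSwinnertonDyer.Rank1Residual

namespace Summit.BirchSwinnertonDyer.BirchSwinnertonDyer.Theorems.PrintCFram.HerbrandUntwist


/-! ## §1 Restriction to a subgroup containing everything is onto; T2 in `resOfLe` currency -/

section Top

variable {K : Type} [Field K]
  {M : Type} [AddCommGroup M] [DistribMulAction (absoluteGaloisGroup K) M] [TopologicalSpace M] [DiscreteTopology M]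

/-- **Restriction `H¹(Γ_K, M) → H¹(H, M)` is surjective when `H` contains every element of `Γ_K`** (e.g. `H = ⊤`, or the layer-`0`
subgroup `κ.layerSubgroup 0` of a `ℤ_p`-extension): the pair `(g ↦ ⟨g, _⟩ : Γ_K → H, id_M)` induces a section.
[cite: SerreGaloisCohomology1997, I.§2.4] -/
theorem resSubgroup_surjective_of_forall_mem (H : Subgroup (absoluteGaloisGroup K))
    (hH : ∀ g : absoluteGaloisGroup K, g ∈ H) : Function.Surjective (ResKernel.resSubgroup H M) := by
  -- the inverse inclusion `e : Γ_K → H`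
  let e : absoluteGaloisGroup K →ₜ* H :=
    { toFun := fun g => ⟨g, hH g⟩
      map_one' := rfl
      map_mul' := fun _ _ => rfl
      continuous_toFun := Continuous.subtype_mk continuous_id _ }
  have he : ∀ (x : absoluteGaloisGroup K) (m : M), (AddMonoidHom.id M) (e x • m) = x • (AddMonoidHom.id M) m :=
    fun _ _ => rfl
  intro y
  refine ⟨resH1Hom e (AddMonoidHom.id M) he y, ?_⟩
  have hcomp := resH1Hom_comp e (AddMonoidHom.id M) he (subgroupIncl H) (AddMonoidHom.id M) (fun _ _ ↦ rfl)
  have hid : (e.comp (subgroupIncl H)) = ContinuousMonoidHom.id H := by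
    ext x; rfl
  have h := congrArg (fun f => f y) hcomp
  simp only [AddMonoidHom.comp_apply] at h
  change resH1Hom (subgroupIncl H) (AddMonoidHom.id M) _ (resH1Hom e (AddMonoidHom.id M) he y) = y
  rw [h, resH1Hom_congr hid (show (AddMonoidHom.id M).comp (AddMonoidHom.id M) = AddMonoidHom.id M from rfl) _
    (fun _ _ ↦ rfl), resH1Hom_id, AddMonoidHom.id_apply]

/-- `res_{H→N} ∘ res_{Γ_K→H} = res_{Γ_K→N}` for `N ≤ H`. [cite: SerreGaloisCohomology1997, I.§2.4] -/
theorem resOfLe_comp_resSubgroup {N H : Subgroup (absoluteGaloisGroup K)} (hNH : N ≤ H) :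
    (resOfLe M hNH).comp (ResKernel.resSubgroup H M) = ResKernel.resSubgroup N M := by
  rw [resOfLe, ResKernel.resSubgroup, ResKernel.resSubgroup, resH1Hom_comp]
  exact resH1Hom_congr (ContinuousMonoidHom.ext fun _ ↦ rfl) (AddMonoidHom.ext fun _ ↦ rfl) _ _

/-- **T2 in `resOfLe` currency.** If restriction `H¹(Γ_K, M) → H¹(N, M)` is injective (`subgroupResKer M N = ⊥`, LEAD g7's
`HerbrandLineRestriction.subgroupResKer_ker_eq_bot_of_cmRamified`) and `H ⊇ N` contains every element of `Γ_K`, then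
`resOfLe M (N ≤ H) : H¹(H, M) → H¹(N, M)` is injective. [cite: SerreGaloisCohomology1997, I.§2.6 (b)] -/
theorem resOfLe_injective_of_subgroupResKer_eq_bot {N H : Subgroup (absoluteGaloisGroup K)} (hNH : N ≤ H)
    (hH : ∀ g : absoluteGaloisGroup K, g ∈ H) (hbot : subgroupResKer M N = ⊥) :
    Function.Injective (resOfLe M hNH) := by
  refine (injective_iff_map_eq_zero _).2 fun x hx ↦ ?_
  obtain ⟨d, rfl⟩ := resSubgroup_surjective_of_forall_mem (M := M) H hH x
  have hd : ResKernel.resSubgroup N M d = 0 := by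
    rw [← resOfLe_comp_resSubgroup (M := M) hNH, AddMonoidHom.comp_apply, hx]
  have hd0 : d ∈ subgroupResKer M N := (ResKernel.mem_subgroupResKer_iff N M d).mpr hd
  rw [hbot, AddSubgroup.mem_bot] at hd0
  rw [hd0, map_zero]

end Top

/-! ## §2 The untwisting: `R(K) = ⊥` from «no invariant class in `R(L_θ)`» -/

section Untwist

variable {K : Type} [Field K] [NumberField K]
  {M : Type} [AddCommGroup M] [DistribMulAction (absoluteGaloisGroup K) M] [TopologicalSpace M] [DiscreteTopology M]

/-- **UNTWISTING (M1 §2, generic).** Let `N ≤ H` be normal subgroups of `Γ_K` with `H ⊇ Γ_K` (the bottom layer), `p` a prime,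
`L` local data at the primes above `p` and `S₀` a set of places. Suppose restriction `H¹(H, M) → H¹(N, M)` is injective and that EVERY
`Γ_K`-invariant class (`conjH1 N M g x = x` for all `g`) of the strict Selmer group `datumStrictSelmer N M p L S₀` over the fixed
field `K̄^N` is zero. Then `datumStrictSelmer H M p L S₀ = ⊥`: restriction preserves the unramified conditions off `S₀ ∪ {p}` and the
strict conditions at `p`, commutes with conjugation, and `Γ_K = H` acts trivially on `H¹(H, M)`.
[cite: GreenbergLNM1716, §3 (PDF p. 86)] [cite: SerreGaloisCohomology1997, I.§2.6 (b)] [cite: GreenbergVatsal2000, §2 pp. 16–17, 20] -/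
theorem datumStrictSelmer_eq_bot_of_forall_invariant_eq_zero {N H : Subgroup (absoluteGaloisGroup K)} [N.Normal] [H.Normal]
    (hNH : N ≤ H) (hH : ∀ g : absoluteGaloisGroup K, g ∈ H) (p : ℕ) (L : Data K M p)
    (S₀ : Set (HeightOneSpectrum (𝓞 K))) (hinj : Function.Injective (resOfLe M hNH))
    (hN : ∀ x ∈ datumStrictSelmer N M p L S₀, (∀ g : absoluteGaloisGroup K, conjH1 N M g x = x) → x = 0) :
    datumStrictSelmer H M p L S₀ = ⊥ := by
  refine (AddSubgroup.eq_bot_iff_forall _).mpr fun c hc ↦ ?_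
  rw [mem_datumStrictSelmer_iff] at hc
  obtain ⟨hunr, hstr⟩ := hc
  -- conjugation acts trivially upstairs (`Γ_K = H`)
  have hconj : ∀ g : absoluteGaloisGroup K, conjH1 H M g c = c := fun g ↦ by
    rw [conjH1_of_mem_holds H M (hH g), AddMonoidHom.id_apply]
  -- restriction commutes with conjugation
  have hcomm : ∀ g : absoluteGaloisGroup K, conjH1 N M g (resOfLe M hNH c) = resOfLe M hNH (conjH1 H M g c) := fun g ↦ by
    rw [← AddMonoidHom.comp_apply, ← resOfLe_comp_conjH1_holds, AddMonoidHom.comp_apply]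
  -- `res c` lies in the strict Selmer group over `K̄^N`
  have hmem : resOfLe M hNH c ∈ datumStrictSelmer N M p L S₀ := by
    rw [mem_datumStrictSelmer_iff]
    refine ⟨ResidualLayer.resOfLe_mem_unramifiedOutside p S₀ hNH hunr, fun v hv σ ↦ ?_⟩
    have h1 := RegularLocusTowerDescent.resOfLe_mem_strictKer_of_mem_strictKer hNH (L v hv) (hstr v hv σ)
    exact (congrArg (fun z => z ∈ (L v hv).strictKer N) (hcomm σ)).mpr h1
  -- and is `Γ_K`-invariant
  have hinv : ∀ g : absoluteGaloisGroup K, conjH1 N M g (resOfLe M hNH c) = resOfLe M hNH c := fun g ↦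
    (hcomm g).trans (congrArg (resOfLe M hNH) (hconj g))
  have h0 := hN _ hmem hinv
  exact (injective_iff_map_eq_zero _).1 hinj c h0

end Untwist

/-! ## §3 On the class, with Stub H's quantifiers: both conclusions from the two untwisted statements -/

section Class

variable {p : ℕ} [hp : Fact p.Prime]

/-- **Stub H ⟸ the untwisted statements (every quadratic `K`, every stable line of order `p`).** For `W/ℚ` CM, `p ≥ 5` CM-ramified,
a quadratic `K`, a `ℤ_p`-extension `κ` of `K` (only its bottom layer `κ.layerSubgroup 0 = Γ_K` enters), a prime `𝔭 ∋ p`, a set of places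
`S` and a `Γ_K`-stable `Φ ≤ W_K[p]` with `#Φ = p`: let `N_S = ker(Γ_K → Aut Φ)` and `N_Q = ker(Γ_K → Aut(W_K[p]/Φ))` (the absolute Galois
groups of the splitting fields `L_θ`, `L_{θ'}`). If every `Γ_K`-invariant class of the strict (BDP-datum) Selmer group over `L_θ` of the
module `Φ` is zero, and likewise for `W_K[p]/Φ` over `L_{θ'}`, then BOTH bottom-layer residual Selmer groups of Stub H vanish:
`datumStrictSelmer (κ.layerSubgroup 0) Φ.Sub p (bdpData Φ.Sub p 𝔭) S = ⊥` and the same for `Φ.Quot`. (T2 supplies the injectivity.)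
[cite: GreenbergLNM1716, §3 (PDF p. 86)] [cite: SerreGaloisCohomology1997, I.§2.6 (b)] [cite: GreenbergVatsal2000, §2 p. 28] -/
theorem stubH_of_untwisted_of_cmRamified (W : WeierstrassCurve ℚ) [W.IsElliptic] (hCM : W.HasCM)
    (hram : CMRamified W p) (h5 : 5 ≤ p) (K : Type) [Field K] [NumberField K] (hK2 : Module.finrank ℚ K = 2)
    (κ : ZpExtension K p) (𝔭 : HeightOneSpectrum (𝓞 K)) (S : Set (HeightOneSpectrum (𝓞 K)))
    (Φ : X2.ResidualDevissageModules.StableSubgroup (absoluteGaloisGroup K) ((W.baseChange K).geomTorsion (p : ℤ)))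
    (hcard : Nat.card Φ.Sub = p)
    (hS : ∀ x ∈ datumStrictSelmer (MulAction.toPermHom (absoluteGaloisGroup K) Φ.Sub).ker Φ.Sub p
        (X11b.AcSelmer.bdpData Φ.Sub p 𝔭) S,
      (∀ g : absoluteGaloisGroup K, conjH1 (MulAction.toPermHom (absoluteGaloisGroup K) Φ.Sub).ker Φ.Sub g x = x) → x = 0)
    (hQ : ∀ y ∈ datumStrictSelmer (MulAction.toPermHom (absoluteGaloisGroup K) Φ.Quot).ker Φ.Quot p
        (X11b.AcSelmer.bdpData Φ.Quot p 𝔭) S,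
      (∀ g : absoluteGaloisGroup K, conjH1 (MulAction.toPermHom (absoluteGaloisGroup K) Φ.Quot).ker Φ.Quot g y = y) → y = 0) :
    datumStrictSelmer (κ.layerSubgroup 0) Φ.Sub p (X11b.AcSelmer.bdpData Φ.Sub p 𝔭) S = ⊥ ∧
      datumStrictSelmer (κ.layerSubgroup 0) Φ.Quot p (X11b.AcSelmer.bdpData Φ.Quot p 𝔭) S = ⊥ := by
  have hH : ∀ g : absoluteGaloisGroup K, g ∈ κ.layerSubgroup 0 := fun g ↦ by
    rw [ZpExtension.layerSubgroup_zero]; exact Subgroup.mem_top g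
  obtain ⟨hbS, hbQ⟩ := HerbrandLineRestriction.subgroupResKer_ker_eq_bot_of_cmRamified W hCM hram h5 K hK2 Φ hcard
  have hNS : (MulAction.toPermHom (absoluteGaloisGroup K) Φ.Sub).ker ≤ κ.layerSubgroup 0 := fun g _ ↦ hH g
  have hNQ : (MulAction.toPermHom (absoluteGaloisGroup K) Φ.Quot).ker ≤ κ.layerSubgroup 0 := fun g _ ↦ hH g
  exact ⟨datumStrictSelmer_eq_bot_of_forall_invariant_eq_zero hNS hH p _ S
      (resOfLe_injective_of_subgroupResKer_eq_bot hNS hH hbS) hS,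
    datumStrictSelmer_eq_bot_of_forall_invariant_eq_zero hNQ hH p _ S
      (resOfLe_injective_of_subgroupResKer_eq_bot hNQ hH hbQ) hQ⟩

end Class

end Summit.BirchSwinnertonDyer.BirchSwinnertonDyer.Theorems.PrintCFram.HerbrandUntwist

end
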